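import Literature.Computability.AlgebraicComplexity.MS21SigmaPiOrbitsProofs
import HarnessLib

/-!
# Medini–Shpilka 2021, Thm 28: uniform `1`-independent maps hit the affine orbit of the continuant
# (`MS2021_thm_28_holds`)

Theorem-only companion of `MS21DenseOrbitsHittingSets.lean` (cell `val-lit`, seat x6 g3): a PROOF of
the typed fact `MS2021_thm_28` — "Let `f(x_1, …, x_n) ∈ C_m^{GLaff_n(F)}`, for `m ≤ n`, and arbitrary
`F`. Then, for any uniform `1`-independent polynomial map `G` over `F`, `f ∘ G ≠ 0`" — following the
printed proof [MediniShpilka2021, proof of Thm 28 = arXiv §4 ‹thmhitcont›, p0020:L5-L24] step by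
step:

1. `C_m(y_1, …, y_m) = ∏_i y_i + C̃_{m-1}` with `deg C̃ ≤ m - 1` ("a multilinear polynomial that has a
   unique monomial of degree `m` and all other monomials are of smaller degree") — here by the
   invariant of the `2 × 2` product `(y_1 1; 1 0) ⋯ (y_k 1; 1 0)`: entry `(0,0) = y_1 ⋯ y_k + (deg ≤ k-1)`,
   the other three entries of degree `≤ k - 1` (`MS2021.cont_eq_prod_X_add`).
2. `f = C_m(ℓ_1 + b_1, …, ℓ_m + b_m) = ∏_i ℓ_i + f̃` with `deg f̃ ≤ m - 1`, `ℓ_i` = the rows of `A`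
   (`Fintype.prod_add` and `MS2021.totalDegree_affSubst_le`).
3. `(∏ ℓ_i) ∘ G = ∏ (ℓ_i ∘ G)` is nonzero (each `ℓ_i ≠ 0` as `A` is invertible, and a nonzero linear
   form composed with a `1`-independent map is nonzero: specialise the control variables to the
   assignment `a_j` of Def 19 — the printed (obs:kwise)(coordsGenInd)) and homogeneous of degree
   `m · d`, `d ≥ 1` the common degree of the coordinates of `G`; `deg (f̃ ∘ G) ≤ (m - 1) · d < m · d`,
   hence `f ∘ G ≠ 0`.

No new definitions, no new facts (D-0026): net debt `−1`. HONEST FRAMING: a known 2021 result is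
now a theorem of the tree; typed ≠ endorsed; `VP ≠ VNP` is NOT proved and this is no progress on it.

## References
* [MediniShpilka2021] D. Medini, A. Shpilka, CCC 2021 (LIPIcs 200:19) Thm 28 (p.19:12) and its proof,
  §4 of arXiv:2102.05632 (held text p0020:L5-L24); Def 19 (`k`-independent maps), Obs 3.1.
-/

noncomputable section

open MvPolynomial Matrix

namespace Literature.Computability.AlgebraicComplexity

namespace MS2021

/-! ### Step 1: the continuant is `∏ y_i` plus terms of degree `≤ m - 1` -/

section ContinuantStructure

variable {R : Type*} [CommSemiring R] {σ : Type*}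

/-- Entries of `(p 1; 1 0) · P`. [folklore] -/
private theorem contStep_mul_apply (P : Matrix (Fin 2) (Fin 2) (MvPolynomial σ R))
    (p : MvPolynomial σ R) :
    (!![p, 1; 1, 0] * P) 0 0 = p * P 0 0 + P 1 0 ∧ (!![p, 1; 1, 0] * P) 0 1 = p * P 0 1 + P 1 1 ∧
      (!![p, 1; 1, 0] * P) 1 0 = P 0 0 ∧ (!![p, 1; 1, 0] * P) 1 1 = P 0 1 := by
  simp [Matrix.mul_apply, Fin.sum_univ_two]

/-- A product of a list of polynomials of degree `≤ 1` has degree at most the length of the list.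
[folklore] -/
private theorem totalDegree_list_prod_le_length (l : List (MvPolynomial σ R))
    (hl : ∀ q ∈ l, q.totalDegree ≤ 1) : l.prod.totalDegree ≤ l.length := by
  refine (totalDegree_list_prod l).trans ?_
  have : (l.map totalDegree).sum ≤ l.length • 1 := by
    rw [← List.length_map (f := totalDegree)]
    exact List.sum_le_card_nsmul _ _ fun d hd => by
      obtain ⟨q, hq, rfl⟩ := List.mem_map.1 hd
      exact hl q hq
  simpa using this

/-- The invariant of the `2 × 2` product `(p 1; 1 0) · (q_1 1; 1 0) ⋯ (q_k 1; 1 0)` for polynomials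
`p, q_j` of degree `≤ 1`: the `(0,0)` entry is `p q_1 ⋯ q_k` up to terms of degree `≤ k`, and the three
other entries have degree `≤ k`. [cite: MediniShpilka2021, proof of Thm 28 (arXiv p0020:L7-L10 "C_m … has a unique monomial of degree m and all other monomials are of smaller degree")] -/
private theorem contList_invariant (l : List (MvPolynomial σ R)) :
    ∀ p : MvPolynomial σ R, p.totalDegree ≤ 1 → (∀ q ∈ l, q.totalDegree ≤ 1) →
      (∃ A : MvPolynomial σ R,
        ((p :: l).map fun q => !![q, 1; 1, 0]).prod 0 0 = (p :: l).prod + A ∧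
          A.totalDegree + 1 ≤ (p :: l).length) ∧
      (((p :: l).map fun q => !![q, 1; 1, 0]).prod 0 1).totalDegree + 1 ≤ (p :: l).length ∧
      (((p :: l).map fun q => !![q, 1; 1, 0]).prod 1 0).totalDegree + 1 ≤ (p :: l).length ∧
      (((p :: l).map fun q => !![q, 1; 1, 0]).prod 1 1).totalDegree + 1 ≤ (p :: l).length := by
  induction l with
  | nil =>
    intro p hp _
    simp only [List.map_cons, List.map_nil, List.prod_cons, List.prod_nil, mul_one,
      List.length_cons, List.length_nil, zero_add]
    refine ⟨⟨0, by simp, by simp⟩, ?_, ?_, ?_⟩ <;> simp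
  | cons q l ih =>
    intro p hp hl
    have hq : q.totalDegree ≤ 1 := hl q (by simp)
    have hl' : ∀ r ∈ l, r.totalDegree ≤ 1 := fun r hr => hl r (by simp [hr])
    obtain ⟨⟨A, hA, hAdeg⟩, h01, h10, h11⟩ := ih q hq hl'
    set Q := ((q :: l).map fun r => !![r, 1; 1, 0]).prod with hQ
    have hprod : ((p :: q :: l).map fun r => !![r, 1; 1, 0]).prod = !![p, 1; 1, 0] * Q := by
      rw [List.map_cons, List.prod_cons]
    obtain ⟨e00, e01, e10, e11⟩ := contStep_mul_apply Q p
    have hlen : (p :: q :: l).length = (q :: l).length + 1 := rfl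
    have hQ00deg : (Q 0 0).totalDegree ≤ (q :: l).length := by
      rw [hA]
      refine (totalDegree_add _ _).trans (max_le ?_ (by omega))
      exact totalDegree_list_prod_le_length _ hl
    rw [hprod, hlen]
    refine ⟨⟨p * A + Q 1 0, ?_, ?_⟩, ?_, ?_, ?_⟩
    · rw [e00, hA]
      simp only [List.prod_cons]
      ring
    · have h1 : (p * A).totalDegree ≤ (q :: l).length :=
        (totalDegree_mul _ _).trans (by omega)
      have := (totalDegree_add (p * A) (Q 1 0)).trans (max_le h1 (by omega))
      omega
    · rw [e01]
      have h1 : (p * Q 0 1).totalDegree ≤ (q :: l).length :=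
        (totalDegree_mul _ _).trans (by omega)
      have := (totalDegree_add (p * Q 0 1) (Q 1 1)).trans (max_le h1 (by omega))
      omega
    · rw [e10]; omega
    · rw [e11]; omega

end ContinuantStructure

section Continuant

variable (K : Type*) [Field K]

/-- **`C_m = ∏_{i} x_i + C̃_{m-1}`, `deg C̃_{m-1} ≤ m - 1`** (`m ≥ 1`): "`C_m(y_1, …, y_m)` is a multilinear
polynomial that has a unique monomial of degree `m` and all other monomials are of smaller degree.
Thus, `C_m(y_1, …, y_m) = ∏_{i=1}^{m} y_i + C̃_{m-1}(y_1, …, y_m)`, where `deg(C̃_{m-1}) ≤ m - 1`."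
[cite: MediniShpilka2021, proof of Thm 28 (arXiv p0020:L7-L10)] -/
theorem cont_eq_prod_X_add (m : ℕ) (hm : 1 ≤ m) :
    ∃ A : MvPolynomial (Fin m) K, cont K m = (∏ i, X i) + A ∧ A.totalDegree + 1 ≤ m := by
  obtain ⟨k, rfl⟩ : ∃ k, m = k + 1 := ⟨m - 1, by omega⟩
  have hlist : (List.ofFn fun i : Fin (k + 1) =>
      (!![X i, 1; 1, 0] : Matrix (Fin 2) (Fin 2) (MvPolynomial (Fin (k + 1)) K))) =
      ((X 0 :: List.ofFn fun i : Fin k => X i.succ).map fun q => !![q, 1; 1, 0]) := by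
    rw [← List.ofFn_succ, List.map_ofFn]; rfl
  have hdeg0 : (X 0 : MvPolynomial (Fin (k + 1)) K).totalDegree ≤ 1 := by
    rw [totalDegree_X]
  have hdegl : ∀ q ∈ (List.ofFn fun i : Fin k => (X i.succ : MvPolynomial (Fin (k + 1)) K)),
      q.totalDegree ≤ 1 := by
    intro q hq
    rw [List.mem_ofFn] at hq
    obtain ⟨i, rfl⟩ := hq
    rw [totalDegree_X]
  obtain ⟨⟨A, hA, hAdeg⟩, -, -, h11⟩ := contList_invariant _ _ hdeg0 hdegl
  simp only [List.length_cons, List.length_ofFn] at hAdeg h11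
  set P11 := ((X 0 :: List.ofFn fun i : Fin k => (X i.succ : MvPolynomial (Fin (k + 1)) K)).map
      fun q => !![q, 1; 1, 0]).prod 1 1 with hP11
  have hA' : ((X 0 :: List.ofFn fun i : Fin k => (X i.succ : MvPolynomial (Fin (k + 1)) K)).map
      fun q => !![q, 1; 1, 0]).prod 0 0 = (∏ i, X i) + A := by
    rw [hA, ← List.ofFn_succ, List.prod_ofFn]
  refine ⟨A + P11, ?_, ?_⟩
  · rw [cont, hlist, Matrix.trace_fin_two, hA', add_assoc]
  · have hlt : (A + P11).totalDegree < k + 1 :=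
      (totalDegree_add A P11).trans_lt (max_lt (by omega) (by omega))
    omega

end Continuant

/-! ### Step 2: `f = C_m(ℓ_1 + b_1, …, ℓ_m + b_m) = ∏ ℓ_i + f̃`, `deg f̃ ≤ m - 1` -/

section AffineStep

variable {K : Type*} [Field K] {m n : ℕ}

/-- A linear form `∑_j a_j x_j` has total degree `≤ 1`. [folklore] -/
private theorem totalDegree_linearForm_le_one (a : Fin n → K) :
    (∑ j, C (a j) * X j : MvPolynomial (Fin n) K).totalDegree ≤ 1 := by
  refine totalDegree_finsetSum_le fun j _ => (totalDegree_mul _ _).trans ?_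
  rw [totalDegree_C, totalDegree_X, zero_add]

/-- **`f = ∏_{i=1}^{m} ℓ_i + f̃` with `deg f̃ ≤ m - 1`** for `f = C_m(ℓ_1(x) + b_1, …, ℓ_m(x) + b_m)`, the
`ℓ_i` being the (first `m`) rows of `A`: "Hence, `f(x) = C_m(ℓ_1(x)+b_1, …, ℓ_m(x)+b_m) = ∏_{i=1}^{m} ℓ_i
+ f̃(ℓ_1, …, ℓ_m)`, where `deg(f̃) ≤ m - 1`." [cite: MediniShpilka2021, proof of Thm 28 (arXiv p0020:L12-L16)] -/
theorem affSubst_cont_eq_prod_add (hm : 1 ≤ m) (h : m ≤ n) (A : Matrix (Fin n) (Fin n) K)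
    (b : Fin n → K) :
    ∃ R : MvPolynomial (Fin n) K,
      affSubst h A b (cont K m) = (∏ i : Fin m, ∑ j : Fin n, C (A (Fin.castLE h i) j) * X j) + R ∧
        R.totalDegree + 1 ≤ m := by
  classical
  obtain ⟨A₀, hcont, hA₀⟩ := cont_eq_prod_X_add K m hm
  -- the substitution applied to `∏ y_i` and to the lower part
  have h1 : affSubst h A b (cont K m) =
      (∏ i : Fin m, ((∑ j : Fin n, C (A (Fin.castLE h i) j) * X j) + C (b (Fin.castLE h i)))) +
        affSubst h A b A₀ := by
    rw [hcont]
    unfold affSubst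
    rw [map_add, map_prod]
    simp only [aeval_X]
  -- expand `∏ (ℓ_i + b_i)` over subsets and split off the full subset
  rw [Fintype.prod_add, ← Finset.add_sum_erase _ _ (Finset.mem_univ (Finset.univ : Finset (Fin m)))]
    at h1
  simp only [Finset.compl_univ, Finset.prod_empty, mul_one] at h1
  refine ⟨(∑ t ∈ (Finset.univ : Finset (Finset (Fin m))).erase Finset.univ,
      (∏ i ∈ t, ∑ j : Fin n, C (A (Fin.castLE h i) j) * X j) * ∏ i ∈ tᶜ, C (b (Fin.castLE h i))) +
      affSubst h A b A₀, by rw [h1, add_assoc], ?_⟩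
  -- degree bound
  obtain ⟨k, rfl⟩ : ∃ k, m = k + 1 := ⟨m - 1, by omega⟩
  have hlow : (affSubst h A b A₀).totalDegree ≤ k := by
    have := totalDegree_affSubst_le h A b A₀
    omega
  have hsum : (∑ t ∈ (Finset.univ : Finset (Finset (Fin (k + 1)))).erase Finset.univ,
      (∏ i ∈ t, ∑ j : Fin n, C (A (Fin.castLE h i) j) * X j) *
        ∏ i ∈ tᶜ, C (b (Fin.castLE h i)) : MvPolynomial (Fin n) K).totalDegree ≤ k := by
    refine totalDegree_finsetSum_le fun t ht => ?_
    have htne : t ≠ Finset.univ := Finset.ne_of_mem_erase ht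
    have htcard : t.card < k + 1 := by
      simpa using (Finset.card_lt_iff_ne_univ t).2 htne
    refine (totalDegree_mul _ _).trans ?_
    have hC : (∏ i ∈ tᶜ, C (b (Fin.castLE h i)) : MvPolynomial (Fin n) K).totalDegree = 0 := by
      rw [← map_prod, totalDegree_C]
    rw [hC, add_zero]
    refine (totalDegree_finsetProd _ _).trans ?_
    refine (Finset.sum_le_card_nsmul _ _ 1 fun i _ => totalDegree_linearForm_le_one _).trans ?_
    simp only [smul_eq_mul, mul_one]
    omega
  exact Nat.succ_le_succ ((totalDegree_add _ _).trans (max_le hsum hlow))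

end AffineStep

/-! ### Step 3: composing with a uniform `1`-independent map -/

section Independent

variable {K : Type*} [Field K] {n t : ℕ}

/-- **Obs 3.1 (coordsGenInd), the case used:** a linear form with a nonzero coefficient composed with a
`1`-independent map is nonzero — substitute the assignment `a_{j₀}` of Def 19 for the control variables,
which turns `G` into `(0, …, 0, z_1, 0, …, 0)` and `ℓ ∘ G` into `c_{j₀} z_1`.
[cite: MediniShpilka2021, Obs 3.1 and Def 19 (arXiv p0017:L6-L12, p0006:L64-L65)] -/
theorem bind₁_linearForm_ne_zero_of_isIndependent_one
    (G : Fin n → MvPolynomial (Fin 1 × (Fin t ⊕ Unit)) K) (hG : IsIndependent 1 G)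
    (c : Fin n → K) (j₀ : Fin n) (hc : c j₀ ≠ 0) :
    bind₁ G (∑ j, C (c j) * X j) ≠ 0 := by
  classical
  obtain ⟨Gs, hGs, hGsum⟩ := hG
  obtain ⟨a, ha⟩ := hGs 0 j₀
  have key : ∀ j, aeval (fun v : Fin 1 × (Fin t ⊕ Unit) =>
      (Sum.elim (fun s => C (a s)) (fun _ => X ()) v.2 : MvPolynomial Unit K)) (G j) =
      if j = j₀ then X () else 0 := by
    intro j
    rw [hGsum j, Fin.sum_univ_one, aeval_rename]
    exact ha j
  intro h0
  have h1 := congr_arg (aeval (fun v : Fin 1 × (Fin t ⊕ Unit) =>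
      (Sum.elim (fun s => C (a s)) (fun _ => X ()) v.2 : MvPolynomial Unit K))) h0
  rw [map_zero, aeval_bind₁] at h1
  simp only [key, map_sum, map_mul, aeval_C, aeval_X, mul_ite, mul_zero, Finset.sum_ite_eq',
    Finset.mem_univ, if_true, algebraMap_eq] at h1
  have h2 := congr_arg (coeff (Finsupp.single () 1)) h1
  rw [coeff_C_mul, coeff_zero, coeff_X, if_pos rfl, mul_one] at h2
  exact hc h2

/-- The common degree of the coordinates of a UNIFORM `1`-independent map into `F^n`, `n ≥ 1`, is at
least `1` (the `j₀`-th coordinate specialises to `z_1`). [cite: MediniShpilka2021, Def 19 (arXiv p0006:L64-L67)] -/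
theorem one_le_degree_of_isUniform_isIndependent_one
    (G : Fin n → MvPolynomial (Fin 1 × (Fin t ⊕ Unit)) K) (hG : IsIndependent 1 G)
    {e : ℕ} (he : ∀ j, (G j).IsHomogeneous e) (j₀ : Fin n) : 1 ≤ e := by
  classical
  obtain ⟨Gs, hGs, hGsum⟩ := hG
  obtain ⟨a, ha⟩ := hGs 0 j₀
  have key : aeval (fun v : Fin 1 × (Fin t ⊕ Unit) =>
      (Sum.elim (fun s => C (a s)) (fun _ => X ()) v.2 : MvPolynomial Unit K)) (G j₀) = X () := by
    have := ha j₀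
    rw [if_pos rfl] at this
    rw [hGsum j₀, Fin.sum_univ_one, aeval_rename]
    exact this
  have hdeg := Literature.RingTheory.Nullstellensatz.totalDegree_aeval_le
    (fun v : Fin 1 × (Fin t ⊕ Unit) =>
      (Sum.elim (fun s => C (a s)) (fun _ => X ()) v.2 : MvPolynomial Unit K)) (δ := 1)
    (fun v => by
      rcases v with ⟨l, s | u⟩
      · simp [totalDegree_C]
      · simp [totalDegree_X]) (G j₀)
  rw [key, totalDegree_X, mul_one] at hdeg
  exact hdeg.trans (he j₀).totalDegree_le

end Independent

end MS2021

/-! ### The theorem -/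

section Thm28

open MS2021

/-- **MS Thm 28 holds** (arXiv ‹thmhitcont›): for `f ∈ C_m^{GLaff_n(F)}`, `1 ≤ m ≤ n`, any field `F`,
and any uniform `1`-independent polynomial map `G`, `f ∘ G ≠ 0`. Printed proof: `f = ∏ ℓ_i + f̃`,
`deg f̃ ≤ m - 1`; `(∏ ℓ_i) ∘ G ≠ 0` is homogeneous of degree `m·d` while `deg(f̃ ∘ G) ≤ (m-1)·d`.
[cite: MediniShpilka2021, Thm 28 (CCC p.19:12) and its proof (arXiv §4 p0020:L5-L24)] -/
theorem MS2021_thm_28_holds : MS2021_thm_28 := by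
  intro K _ n m t hm hmn f hf G hG hU
  classical
  obtain ⟨h, A, b, hA, rfl⟩ := hf
  obtain ⟨R, hR, hRdeg⟩ := affSubst_cont_eq_prod_add hm h A b
  obtain ⟨e, he⟩ := hU
  -- the rows of the invertible matrix `A` are nonzero
  have hrow : ∀ i : Fin m, ∃ j, A (Fin.castLE h i) j ≠ 0 := by
    intro i
    by_contra hcon
    push Not at hcon
    exact hA.ne_zero (Matrix.det_eq_zero_of_row_eq_zero (Fin.castLE h i) hcon)
  -- `ℓ_i ∘ G ≠ 0`, homogeneous of degree `e`
  have hne : ∀ i : Fin m, bind₁ G (∑ j, C (A (Fin.castLE h i) j) * X j) ≠ 0 := fun i => by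
    obtain ⟨j₀, hj₀⟩ := hrow i
    exact bind₁_linearForm_ne_zero_of_isIndependent_one G hG _ j₀ hj₀
  have hhom : ∀ i : Fin m, (bind₁ G (∑ j, C (A (Fin.castLE h i) j) * X j)).IsHomogeneous e := by
    intro i
    rw [map_sum]
    refine IsHomogeneous.sum _ _ _ fun j _ => ?_
    rw [map_mul, bind₁_C_right, bind₁_X_right]
    exact (he j).C_mul _
  have hprodne : (∏ i : Fin m, bind₁ G (∑ j, C (A (Fin.castLE h i) j) * X j)) ≠ 0 :=
    Finset.prod_ne_zero_iff.2 fun i _ => hne i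
  have hprodhom :
      (∏ i : Fin m, bind₁ G (∑ j, C (A (Fin.castLE h i) j) * X j)).IsHomogeneous (m * e) := by
    have := IsHomogeneous.prod Finset.univ
      (fun i : Fin m => bind₁ G (∑ j, C (A (Fin.castLE h i) j) * X j)) (fun _ => e)
      fun i _ => hhom i
    simpa using this
  -- the common degree is `≥ 1` (here `n ≥ m ≥ 1`)
  have he1 : 1 ≤ e :=
    one_le_degree_of_isUniform_isIndependent_one G hG he (Fin.castLE h ⟨0, hm⟩)
  -- `deg (f̃ ∘ G) ≤ deg f̃ · e`
  have hdegR : (bind₁ G R).totalDegree ≤ R.totalDegree * e := by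
    rw [← aeval_eq_bind₁]
    exact Literature.RingTheory.Nullstellensatz.totalDegree_aeval_le G
      (fun j => (he j).totalDegree_le) R
  -- conclude by comparing degrees
  intro h0
  rw [hR, map_add, map_prod] at h0
  have heq := eq_neg_of_add_eq_zero_left h0
  have hdeg1 := hprodhom.totalDegree hprodne
  rw [heq, totalDegree_neg] at hdeg1
  -- `m * e = deg (f̃ ∘ G) ≤ deg f̃ * e ≤ (m - 1) * e`
  have hle : m * e ≤ R.totalDegree * e := hdeg1 ▸ hdegR
  have hle' : (R.totalDegree + 1) * e ≤ m * e := Nat.mul_le_mul_right e hRdeg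
  rw [Nat.add_mul, one_mul] at hle'
  generalize R.totalDegree * e = D at hle hle'
  omega

end Thm28


end Literature.Computability.AlgebraicComplexity

end
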